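import Summits.PneNP.PneNP.Theorems.PstarSASDPPairs

/-!
# T21.1c — linear-level Sherali–Adams + SDP feasibility of every fibre of an expanding typed `P⋆` map (the leaf)

FRONTIER range-avoidance ladder, rung F-N3 context (restricted-model lower bound for the MIXED Sherali–Adams + SDP hierarchy
on typed `P⋆`; cell `pnp-ideate`, ROUND-21 item T21.1c — nothing here bears on `P` vs `NP`).

`typedSASDPLinearLevel : PstarSASDPLevel.TypedSASDPLinearLevel` with `c = 112`: on every typed pure-`P⋆` instance that is
`(r, 7/4)`-boundary expanding with simple overlaps, the fibre `I(x) = y` of EVERY target `y` is feasible for level-`r/112`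
Sherali–Adams together with positive semidefiniteness of the level-2 moment matrix (Benabbas–Georgiou–Magen–Tulsiani 2012,
Thm 4.3, transferred with type-consistent biases in place of balance).

The laws are those of T21.1 (`S ↦ law I y (cl S)`, closure from `PstarSAClosure.exists_closure`, assembly
`saProps_of_closure`) when the level `t = r/112` is at least `4`, and simply the bias-product law `W I y ∅` when `t ≤ 3`
(then no output constraint lives inside a set of `≤ t` variables).  The new point is the biased BGMT Claim 3.4: the
singleton and pair pseudo-marginals of the family are `bias v` and `bias v · bias w` — for the closure laws because
`{v}`, `{v, w}` dominate nothing and `G − {v, w}` stays strictly expanding under ratio `7/4` + simple overlaps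
(`strictExpandingOff_of_card_le_two`), so `law_consistent` pulls the marginal back to the bias-product law — hence the
moment matrix is the product one and `PstarSA2Blind.posSemidef_momentMatrix_product` applies.
-/

set_option linter.dupNamespace false

open Finset Literature.Computability.Complexity
open Summit.PneNP.PneNP.Theorems.PstarSA2Blind (momentMatrix posSemidef_momentMatrix_product)
open Summit.PneNP.PneNP.Theorems.PstarSALevel (cyl varSet bdry BoundaryExpanding SimpleOverlap)
open Summit.PneNP.PneNP.Theorems.PstarSASDPLevel (BoundaryExpandingQ single pair SASDPFeasible TypedSASDPLinearLevel
  boundaryExpanding_of_Q74)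
open Summit.PneNP.PneNP.Theorems.PstarSAPeeling
open Summit.PneNP.PneNP.Theorems.PstarSAClosure (exists_closure)
open Summit.PneNP.PneNP.Theorems.PstarTypedSALinearLevel (card_dom_le)

namespace Summit.PneNP.PneNP.Theorems.PstarTypedSASDPLinearLevel

variable {n m : ℕ}

/-- **T21.1c — LINEAR-LEVEL SA+SDP FEASIBILITY FOR TYPED `P⋆` (every target).**  With `c = 112`: on a typed pure-`P⋆`
instance that is `(r, 7/4)`-boundary expanding with simple overlaps, the fibre of every `y ∈ {0,1}^m` is feasible for
level-`r/112` Sherali–Adams plus the PSD level-2 moment matrix — so no certificate of that class (all local LP reasoning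
plus every degree-2 spectral/SDP argument, the ROUND-19 isolation certificate included) refutes "`y ∈ Range(I)`" for any
`y`.  Restricted-model lower bound for a relaxation hierarchy (cell pnp-ideate, ROUND-21); it says nothing about `P`
versus `NP`. -/
theorem typedSASDPLinearLevel : TypedSASDPLinearLevel := by
  refine ⟨112, by norm_num, fun n m r I hI hT hB74 hSO y => ?_⟩
  classical
  have hB : BoundaryExpanding r I := boundaryExpanding_of_Q74 hB74
  have hp : ∀ v, 0 ≤ bias I v ∧ bias I v ≤ 1 := bias_mem_unitInterval I
  set t : ℕ := r / 112 with ht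
  by_cases hsmall : t ≤ 3
  · -- small level: the bias-product law everywhere (no constraint lives inside `≤ 3` variables)
    refine ⟨fun _ => W I y ∅, fun S _ => ⟨fun x => W_nonneg I y ∅ x, sum_W_empty I y⟩, fun S T _ _ a => rfl,
      fun S j hS hj x _ => ?_, ?_⟩
    · exfalso
      have h4 := card_le_card hj
      rw [card_varSet hI] at h4
      omega
    · have hs : single (fun _ : Finset (Fin n) => W I y ∅) = bias I := funext fun v => single_W_empty I y v
      have hpq : ∀ u v : Fin n, u ≠ v → pair (fun _ : Finset (Fin n) => W I y ∅) u v = bias I u * bias I v :=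
        fun u v huv => pair_W_empty I y huv
      rw [hs, momentMatrix_congr_offDiag (bias I) hpq]
      exact posSemidef_momentMatrix_product (bias I) hp
  · -- level `t ≥ 4`: the closure laws of T21.1
    push Not at hsmall
    have hr : 28 * t ≤ r := by omega
    choose cl hsub hcard hclosed using fun S : Finset (Fin n) => exists_closure I r hB S
    obtain ⟨h1, h2, h3⟩ := saProps_of_closure I y t (34 * t) (ClosedAt I r t) cl (law I y) hsub
      (fun S hS M hM hnd hbud => hclosed S M hM hnd (by omega))
      (fun S hS => by have := hcard S; omega)
      (fun S x => law_nonneg I y S x)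
      (fun S hS => law_total_of_budget hI hT hB hr y hS)
      (fun S j x hj hx => law_support hI y hj hx)
      (fun S₁ S₂ hC h12 hS₂ a => law_consistent_of_closedAt hI hT hB hr y hC h12 hS₂ a)
    refine ⟨fun S => law I y (cl S), h1, h2, h3, ?_⟩
    -- biased BGMT Claim 3.4: singleton / pair marginals of the closure laws are those of the bias-product law
    have hmarg : ∀ T₀ : Finset (Fin n), T₀.card ≤ 2 →
        cyl (law I y (cl T₀)) T₀ (fun _ => true) = cyl (W I y ∅) T₀ (fun _ => true) := by
      intro T₀ hT₀
      have hdom0 : dom I T₀ = ∅ := dom_eq_empty_of_card_lt hI (by omega)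
      have hcl : (cl T₀).card ≤ 34 := by have := hcard T₀; omega
      have hlt : 2 * (cl T₀).card < 3 * r := by omega
      have hdomr : (dom I (cl T₀)).card ≤ r := (card_dom_le hB hlt).1
      have hexp : StrictExpandingOff I T₀ (dom I (cl T₀) \ dom I T₀) := by
        rw [hdom0, sdiff_empty]
        exact strictExpandingOff_of_card_le_two hI hSO hB74 hT₀ hdomr
      have h := law_consistent hI hT y (hsub T₀) hexp (fun _ => true)
      rw [h]
      unfold law
      rw [hdom0]
    have hs : single (fun S => law I y (cl S)) = bias I := by
      funext v
      show cyl (law I y (cl {v})) {v} (fun _ => true) = bias I v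
      rw [hmarg {v} (by simp), single_W_empty]
    have hpq : ∀ u v : Fin n, u ≠ v → pair (fun S => law I y (cl S)) u v = bias I u * bias I v := by
      intro u v huv
      show cyl (law I y (cl {u, v})) {u, v} (fun _ => true) = _
      rw [hmarg {u, v} (by rw [card_pair huv]), pair_W_empty I y huv]
    rw [hs, momentMatrix_congr_offDiag (bias I) hpq]
    exact posSemidef_momentMatrix_product (bias I) hp

end Summit.PneNP.PneNP.Theorems.PstarTypedSASDPLinearLevel
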